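import Summits.ValiantsHypothesis.ValiantsHypothesis.Theorems.BarrierLeverChowHitsPartitionMinorsRStarvedRows

/-!
# Route BarrierLever — item `ChowHitsPartitionMinorsR` (stmt-ValiantsHypothesis-21882), STARVED DESIGN II:
# truncated inverses — the thin rows of `∏ ℓ_k` are `F · ρ̂_U` on columns of size `≤ 3`

Helper file (`--supports stmt-ValiantsHypothesis-21882`; cell valiant-natproofs, rung V4, 𝒟-side; prover seat val-np-p5
gen 31). Definition-free. Closes NO item. Second file of the kernel chain for THEOREM A′ of memo MEMO-21882-valnp5-g31.md
§3/§5 (K-A2), continuing `…RStarvedRows` (p723885: the thin rows of a product `∏_{k∈K} ℓ_k` of affine forms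
`ℓ_k = 1 + Σ_a A k a · x_a + Σ_c B k c · y_c` over an arbitrary index type, as sums of leave-out products `Λ_S` of the
`y`-parts `λ_k = 1 + N_k`, `N_k = Σ_c B k c · y_c`).

THE UNIT REDUCTION, POLYNOMIALLY.  With the degree-3 TRUNCATED INVERSE `t_k = 1 − N_k + N_k² − N_k³` one has
`λ_k · t_k = 1 − N_k⁴` (`lam_mul_tinv`), and a multiple of `N_k⁴` has no coefficient at an exponent `E U T` with
`|T| ≤ 3` (`coeff_partitionExpo_mul_linY_pow_eq_zero`: each factor `N_k` eats one element of `T`,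
`ChowFactor.coeff_partitionExpo_mul_affineY`). Hence on columns `T` of size `≤ 3` (all faces of the starved-type
column families) the leave-out products are `F · t_k` and `F · t_k t_{k'}`, `F = Λ_∅ = ∏_k λ_k` (`coeff_leaveOneOut`,
`coeff_leaveTwoOut`), and the thin rows of `∏ ℓ` read (`coeff_empty_prodForms` of K-A1, `coeff_single_prod_eq`, `coeff_pair_prod_eq`):
  `coeff (E ∅ T) ∏ℓ = coeff (E ∅ T) F`,
  `coeff (E {a} T) ∏ℓ = coeff (E ∅ T) (F · Σ_k A k a · t_k)`,
  `coeff (E {a,b} T) ∏ℓ = coeff (E ∅ T) (F · Σ_k Σ_{k'≠k} A k a · A k' b · t_k t_{k'})`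
— the partition matrix of `∏ℓ` on (thin rows) × (columns of size `≤ 3`) is the coefficient matrix of the explicit
`y`-polynomials `ρ̂_∅ = 1`, `ρ̂_a = Σ_k A k a · t_k`, `ρ̂_{ab} = Σ_{k≠k'} A k a A k' b · t_k t_{k'}` multiplied by the pure-`y`
unit `F` (to be discarded by `ChowFacePrivate.det_partitionMatrix_mul_pureY_ne_zero_iff`, p714053, in K-A3).

WHAT THIS IS NOT: no determinant is evaluated here; nothing on crux stmt-ValiantsHypothesis-14610 or on `VP` versus `VNP`.
-/

set_option linter.dupNamespace false

namespace Summit.ValiantsHypothesis.ValiantsHypothesis.Theorems.BarrierLever.ChowStarvedDesign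

open Finset MvPolynomial
open Summit.ValiantsHypothesis.ValiantsHypothesis.Theorems.BarrierLever.ChowFactor
  (coeff_partitionExpo_mul_affineY)

variable {h : ℕ} {ι : Type*} [DecidableEq ι]

/-! ## 1. A linear `y`-factor eats one column element -/

omit [DecidableEq ι] in
/-- One LINEAR `y`-only factor: `coeff (E U T) (f · Σ_c b_c y_c) = Σ_{c ∈ T} b_c · coeff (E U (T.erase c)) f`. -/
theorem coeff_partitionExpo_mul_linY (f : MvPolynomial (Fin (h + h)) ℂ) (b : Fin h → ℂ) (U T : Finset (Fin h)) :
    coeff (∑ a ∈ U, Finsupp.single (Fin.castAdd h a) 1 + ∑ c ∈ T, Finsupp.single (Fin.natAdd h c) 1)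
        (f * ∑ c, C (b c) * X (Fin.natAdd h c)) =
      ∑ c ∈ T, b c * coeff (∑ a ∈ U, Finsupp.single (Fin.castAdd h a) 1 +
          ∑ c' ∈ T.erase c, Finsupp.single (Fin.natAdd h c') 1) f := by
  have e := coeff_partitionExpo_mul_affineY f b U T
  rw [mul_add, mul_one, coeff_add] at e
  have e' := congrArg (fun z => z - coeff (∑ a ∈ U, Finsupp.single (Fin.castAdd h a) 1 +
      ∑ c ∈ T, Finsupp.single (Fin.natAdd h c) 1) f) e
  simp only [add_sub_cancel_left] at e'
  exact e'

omit [DecidableEq ι] in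
/-- A multiple of the `n`-th power of a linear `y`-form has no coefficient at `E U T` when `|T| < n`. -/
theorem coeff_partitionExpo_mul_linY_pow_eq_zero (b : Fin h → ℂ) (n : ℕ) :
    ∀ (f : MvPolynomial (Fin (h + h)) ℂ) (U T : Finset (Fin h)), T.card < n →
      coeff (∑ a ∈ U, Finsupp.single (Fin.castAdd h a) 1 + ∑ c ∈ T, Finsupp.single (Fin.natAdd h c) 1)
        (f * (∑ c, C (b c) * X (Fin.natAdd h c)) ^ n) = 0 := by
  induction n with
  | zero => intro f U T hT; exact absurd hT (Nat.not_lt_zero _)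
  | succ n ih =>
    intro f U T hT
    rw [pow_succ, ← mul_assoc, coeff_partitionExpo_mul_linY]
    refine Finset.sum_eq_zero fun c hc => ?_
    have hpos := Finset.card_pos.mpr ⟨c, hc⟩
    rw [ih f U (T.erase c) (by rw [Finset.card_erase_of_mem hc]; omega), mul_zero]

/-! ## 2. Truncated inverses -/

omit [DecidableEq ι] in
/-- `(1 + N) · (1 − N + N² − N³) = 1 − N⁴`. -/
theorem lam_mul_tinv (N : MvPolynomial (Fin (h + h)) ℂ) :
    (1 + N) * (1 - N + N ^ 2 - N ^ 3) = 1 - N ^ 4 := by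
  ring

/-- **Leave-one-out = `F · t_k`** on columns of size `≤ 3`. -/
theorem coeff_leaveOneOut (B : ι → Fin h → ℂ) (K : Finset ι) (k : ι) (hk : k ∈ K)
    (T : Finset (Fin h)) (hT : T.card ≤ 3) :
    coeff (∑ a ∈ (∅ : Finset (Fin h)), Finsupp.single (Fin.castAdd h a) 1 +
        ∑ c ∈ T, Finsupp.single (Fin.natAdd h c) 1)
        (∏ k' ∈ K.erase k, ((1 + ∑ c, C (B k' c) * X (Fin.natAdd h c)) : MvPolynomial (Fin (h + h)) ℂ)) =
      coeff (∑ a ∈ (∅ : Finset (Fin h)), Finsupp.single (Fin.castAdd h a) 1 +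
          ∑ c ∈ T, Finsupp.single (Fin.natAdd h c) 1)
        ((∏ k' ∈ K, ((1 + ∑ c, C (B k' c) * X (Fin.natAdd h c)) : MvPolynomial (Fin (h + h)) ℂ)) *
          (1 - (∑ c, C (B k c) * X (Fin.natAdd h c)) + (∑ c, C (B k c) * X (Fin.natAdd h c)) ^ 2 -
            (∑ c, C (B k c) * X (Fin.natAdd h c)) ^ 3)) := by
  rw [← Finset.mul_prod_erase K _ hk]
  set G : MvPolynomial (Fin (h + h)) ℂ :=
    ∏ k' ∈ K.erase k, ((1 + ∑ c, C (B k' c) * X (Fin.natAdd h c)) : MvPolynomial (Fin (h + h)) ℂ) with hG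
  set N : MvPolynomial (Fin (h + h)) ℂ := ∑ c, C (B k c) * X (Fin.natAdd h c) with hN
  have e1 : (1 + N) * G * (1 - N + N ^ 2 - N ^ 3) = G - G * N ^ 4 := by
    have := lam_mul_tinv N
    linear_combination G * this
  rw [e1, coeff_sub, coeff_partitionExpo_mul_linY_pow_eq_zero (B k) 4 G ∅ T (by omega), sub_zero]

/-- **Leave-two-out = `F · t_k · t_{k'}`** on columns of size `≤ 3`. -/
theorem coeff_leaveTwoOut (B : ι → Fin h → ℂ) (K : Finset ι) (k : ι) (hk : k ∈ K) (k' : ι)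
    (hk' : k' ∈ K.erase k) (T : Finset (Fin h)) (hT : T.card ≤ 3) :
    coeff (∑ a ∈ (∅ : Finset (Fin h)), Finsupp.single (Fin.castAdd h a) 1 +
        ∑ c ∈ T, Finsupp.single (Fin.natAdd h c) 1)
        (∏ j ∈ (K.erase k).erase k', ((1 + ∑ c, C (B j c) * X (Fin.natAdd h c)) : MvPolynomial (Fin (h + h)) ℂ)) =
      coeff (∑ a ∈ (∅ : Finset (Fin h)), Finsupp.single (Fin.castAdd h a) 1 +
          ∑ c ∈ T, Finsupp.single (Fin.natAdd h c) 1)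
        ((∏ j ∈ K, ((1 + ∑ c, C (B j c) * X (Fin.natAdd h c)) : MvPolynomial (Fin (h + h)) ℂ)) *
          ((1 - (∑ c, C (B k c) * X (Fin.natAdd h c)) + (∑ c, C (B k c) * X (Fin.natAdd h c)) ^ 2 -
              (∑ c, C (B k c) * X (Fin.natAdd h c)) ^ 3) *
            (1 - (∑ c, C (B k' c) * X (Fin.natAdd h c)) + (∑ c, C (B k' c) * X (Fin.natAdd h c)) ^ 2 -
              (∑ c, C (B k' c) * X (Fin.natAdd h c)) ^ 3))) := by
  rw [← Finset.mul_prod_erase K _ hk, ← Finset.mul_prod_erase (K.erase k) _ hk']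
  set G : MvPolynomial (Fin (h + h)) ℂ :=
    ∏ j ∈ (K.erase k).erase k', ((1 + ∑ c, C (B j c) * X (Fin.natAdd h c)) : MvPolynomial (Fin (h + h)) ℂ) with hG
  set N : MvPolynomial (Fin (h + h)) ℂ := ∑ c, C (B k c) * X (Fin.natAdd h c) with hN
  set N' : MvPolynomial (Fin (h + h)) ℂ := ∑ c, C (B k' c) * X (Fin.natAdd h c) with hN'
  have e1 : (1 + N) * ((1 + N') * G) * ((1 - N + N ^ 2 - N ^ 3) * (1 - N' + N' ^ 2 - N' ^ 3)) =
      G - (G * (1 - N' ^ 4)) * N ^ 4 - G * N' ^ 4 := by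
    have h1 := lam_mul_tinv N
    have h2 := lam_mul_tinv N'
    linear_combination ((1 + N') * G * (1 - N' + N' ^ 2 - N' ^ 3)) * h1 + (G - G * N ^ 4) * h2
  rw [e1, coeff_sub, coeff_sub, coeff_partitionExpo_mul_linY_pow_eq_zero (B k) 4 _ ∅ T (by omega),
    coeff_partitionExpo_mul_linY_pow_eq_zero (B k') 4 G ∅ T (by omega), sub_zero, sub_zero]

/-! ## 3. The thin rows of `∏ ℓ` as `F · ρ̂_U` -/

/-- **Row `{a}` of `∏ℓ` is `F · ρ̂_a`, `ρ̂_a = Σ_k A k a · t_k`**, on columns of size `≤ 3`. -/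
theorem coeff_single_prod_eq (A B : ι → Fin h → ℂ) (K : Finset ι) (a : Fin h) (T : Finset (Fin h))
    (hT : T.card ≤ 3) :
    coeff (∑ a' ∈ ({a} : Finset (Fin h)), Finsupp.single (Fin.castAdd h a') 1 +
        ∑ c ∈ T, Finsupp.single (Fin.natAdd h c) 1)
        (∏ k ∈ K, ((C 1 + ∑ a, C (A k a) * X (Fin.castAdd h a) + ∑ c, C (B k c) * X (Fin.natAdd h c)) :
          MvPolynomial (Fin (h + h)) ℂ)) =
      coeff (∑ a ∈ (∅ : Finset (Fin h)), Finsupp.single (Fin.castAdd h a) 1 +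
          ∑ c ∈ T, Finsupp.single (Fin.natAdd h c) 1)
        ((∏ k ∈ K, ((1 + ∑ c, C (B k c) * X (Fin.natAdd h c)) : MvPolynomial (Fin (h + h)) ℂ)) *
          ∑ k ∈ K, C (A k a) * (1 - (∑ c, C (B k c) * X (Fin.natAdd h c)) + (∑ c, C (B k c) * X (Fin.natAdd h c)) ^ 2 -
            (∑ c, C (B k c) * X (Fin.natAdd h c)) ^ 3)) := by
  rw [coeff_single_prodForms, Finset.mul_sum, coeff_sum]
  refine Finset.sum_congr rfl fun k hk => ?_
  rw [coeff_leaveOneOut B K k hk T hT]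
  conv_rhs => rw [mul_left_comm, coeff_C_mul]

/-- **Row `{a,b}` of `∏ℓ` is `F · ρ̂_{ab}`, `ρ̂_{ab} = Σ_k Σ_{k' ≠ k} A k a · A k' b · t_k t_{k'}`**, on columns of
size `≤ 3` (`a ≠ b`). -/
theorem coeff_pair_prod_eq (A B : ι → Fin h → ℂ) (K : Finset ι) (a b : Fin h) (hab : a ≠ b)
    (T : Finset (Fin h)) (hT : T.card ≤ 3) :
    coeff (∑ a' ∈ ({a, b} : Finset (Fin h)), Finsupp.single (Fin.castAdd h a') 1 +
        ∑ c ∈ T, Finsupp.single (Fin.natAdd h c) 1)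
        (∏ k ∈ K, ((C 1 + ∑ a, C (A k a) * X (Fin.castAdd h a) + ∑ c, C (B k c) * X (Fin.natAdd h c)) :
          MvPolynomial (Fin (h + h)) ℂ)) =
      coeff (∑ a ∈ (∅ : Finset (Fin h)), Finsupp.single (Fin.castAdd h a) 1 +
          ∑ c ∈ T, Finsupp.single (Fin.natAdd h c) 1)
        ((∏ k ∈ K, ((1 + ∑ c, C (B k c) * X (Fin.natAdd h c)) : MvPolynomial (Fin (h + h)) ℂ)) *
          ∑ k ∈ K, ∑ k' ∈ K.erase k, C (A k a * A k' b) *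
            ((1 - (∑ c, C (B k c) * X (Fin.natAdd h c)) + (∑ c, C (B k c) * X (Fin.natAdd h c)) ^ 2 -
                (∑ c, C (B k c) * X (Fin.natAdd h c)) ^ 3) *
              (1 - (∑ c, C (B k' c) * X (Fin.natAdd h c)) + (∑ c, C (B k' c) * X (Fin.natAdd h c)) ^ 2 -
                (∑ c, C (B k' c) * X (Fin.natAdd h c)) ^ 3))) := by
  rw [coeff_pair_prodForms A B K a b hab, Finset.mul_sum, coeff_sum]
  refine Finset.sum_congr rfl fun k hk => ?_
  rw [Finset.mul_sum, coeff_sum]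
  refine Finset.sum_congr rfl fun k' hk' => ?_
  rw [coeff_leaveTwoOut B K k hk k' hk' T hT]
  conv_rhs => rw [mul_left_comm, coeff_C_mul]

end Summit.ValiantsHypothesis.ValiantsHypothesis.Theorems.BarrierLever.ChowStarvedDesign
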